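import Summits.HodgeConjecture.HodgeConjecture.Cruxes.BlochSeedDiscOne.SeedChecker
import HarnessLib

/-!
# Seed checker v21 (c5c8-1 g20): C7 AT THE LCI DOOR, READ BEFORE A SECTION EXISTS — the Bloch map of a zero locus
# as the ADJUGATE ATIYAH TRACE (the «high-twist Bloch dictionary» of g16 §4 (L5), settled [pen] and typed as a named law)

Cell `pub-hsemireg`, explicit unit `hsemireg-c5c8-1` (MINT A5: type C5–C8 as predicates on (design json, presentation) «so a
seed checker exists before a candidate does»), generation g20. Companion to the ONLY built checker module
`SeedChecker.lean` (v4, §7.3: `IsZeroSchemeOf`, `TopChernFourLocalisation`, `Design.seedCheck_of_zeroScheme`,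
`blochSeedDiscOne_of_zeroSchemes`), which this file imports and extends; it imports none of the unbuilt satellites v5–v20.

## What v4 left open at the lci door, and what this file types

v4 discharges (σ) for the zero scheme `Z = Z(s)` of a section `s` of a rank-`4` bundle `𝓕` on the anchor `S⁴ = (pad4Anchor E₀).X`
(modulo the law `TopChernFourLocalisation`), but keeps **C7 = `IsBlochSemiregular i (2·4) 4`** as a bare hypothesis on the OBJECT
`i : Z ↪ S⁴` — a condition that cannot be read until a section and its zero scheme exist. The successor question of record
(g16 §4 (L5), g17 §5 (2), g19 §6) was: *is Bloch's semiregularity map of `Z(s)` expressible through the sheaf-side data of `𝓕`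
(the Buchweitz–Flenner components `σ̃_q = Tr(∗·At(𝓕)^q)`, the tree's REAL `sigmaHigher`), so that C7 becomes a check on
(design, presentation) alone?* g16 conjectured «`π_{Z(s)} ≐ c·σ̃₃`». That is FALSE for rank `≥ 2`; the correct dictionary is:

**(L5⁺) [pen; BF2003 §8 + the Koszul resolution; NOT a theorem of this file].** Let `X` be smooth projective of dimension `8`,
`𝓕` locally free of rank `4`, `s ∈ H⁰(𝓕)` a REGULAR section, `Z = Z(s)` (lci of codimension `4`, `𝒩_{Z∕X} = 𝓕|_Z`), and assume the
KOSZUL WINDOW vanishings `H¹(𝓕) = H²(𝓕) = 0`, `H^q(𝓕 ⊗ Λ^j 𝓕^∨) = 0` for `2 ≤ j ≤ 4`, `j ≤ q ≤ j+1` (automatic for `𝓕 = 𝓔(tΘ)`,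
`t ≫ 0`, by Serre vanishing — the twists `(1−j)t` are negative and the degrees `q ≤ 5 < 8`). Then
1. (Koszul) `Φ_s : H²(X, 𝓔nd 𝓕) ⥲ H²(𝓕 ⊗ 𝓘_Z) ⥲ H¹(Z, 𝒩_{Z∕X})`, `ξ ↦ δ⁻¹(ξ·s)`, is an ISOMORPHISM (hypercohomology of the Koszul
   resolution `𝓕 ⊗ Λ^•𝓕^∨ → 𝓕 ⊗ 𝓘_Z`; the window kills every other `E₁`-term of total degree `2` and every differential into `E^{0,2}`);
2. (BF Prop. 8.2 `τ = σ ∘ (Atiyah–Chern character of 𝒪_Z)`, Lemma 8.4 `At(𝒪_Z) = [∂, ∇]` on the Koszul complex, and the staircase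
   cocycle `ι_ñ ∓ D_{ξᵀ}` representing the image of `Φ_s ξ` in `Ext²_X(𝒪_Z, 𝒪_Z)`: only the Hom-degree-`0` word `A³·D_{ξᵀ}` of
   `(A + B + ε(…))⁴` survives the trace) **`π_Z ∘ Φ_s = ± D_ξ det(At 𝓕) = ± Tr(ξ · adj At(𝓕)) = ± Σ_{j=0}^{3} c_{3−j}(𝓕) ∪ σ̃_j(ξ)`**
   — Jacobi's formula `D_ξ e₄(Y) = Σ_j (−1)^j e_{3−j}(Y)·Tr(Y^j ξ)` (checked by exact evaluation, g20 memo §2) with `e_k(At 𝓕) =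
   (−1)^k c_k(𝓕)` (BF: `ch = Tr exp(−At)`); RAW traces `σ̃_j = Tr(ξ·At^j)` = the tree's `sigmaHigher` convention (no `(−1)^j∕j!`).
   In particular **`π_Z ∘ Φ_s` does not depend on `s`**: C7 of `Z(s)` is a property of `𝓕` (design + presentation), as the MINT wants.
3. (E-form, `𝓕 = 𝓔(tΘ)`, `At(𝓕) = At(𝓔) − t·h`, `h = c₁(𝒪(Θ))`, (A1)-clean `𝓔` with `c_m(𝓔) = γ_m h^m`): the same map is the
   **Bloch pencil** `Π_t = Σ_{i=0}^{3} v_{3−i}(t)·(h^{3−i} ∪ σ̃_i^{𝓔})`, `v_k(t) = Σ_{m ≤ k} γ_m t^{k−m}` (`v₀ = 1`, `v₁ = γ₁ + t`,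
   `v₂ = γ₂ + γ₁t + t²`, `v₃ = γ₃ + γ₂t + γ₁t² + t³`; i.e. `c(𝓔 − 𝒪(−tΘ))`), checked by exact evaluation (memo §2).
Consequences: C7 at the lci door ⟺ `Π` injective on `Ext²(𝓕, 𝓕)`; NECESSARY: `σ̃₀, …, σ̃₃` (cupped) jointly injective — so the
sheaf door's window-`{1,2,3,4}` semiregularity is necessary for the lci door's (§21.2, `isISemiregular_of_blochAdjugate_injective`);
BUDGET: `dim Ext²(𝓕,𝓕) ≤ h^{3,5}(S⁴) = C(8,3)·C(8,5) = 3136` (= v6.2's `lciDoorBudget`; §21.1); on the joint kernel of the LOWER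
cupped sigmas the Bloch map IS `σ̃₃` (g16's (L5) holds exactly there).

## Contents

§21.1 `BlochPencil` — the pencil as PURE ALGEBRA over a commutative ring (`pencil`, on `→+` carriers) and over a field (`pencilₗ`,
for budgets): apply lemma, vanishing on the joint kernel, `σ̃₃` on the lower joint kernel, the untwisted value, the budget
`finrank V ≤ finrank W` and its contrapositive, `C(8,3)·C(8,5) = 3136`. All proved.
§21.2 the OBJECT side on honest carriers: `HodgeToBetti X` (hypothesis STRUCTURE: an injective realisation `H^b(X, Ω^a) ↪ H^{a+b}(X(ℂ); ℂ)`
— Dolbeault + Hodge decomposition; data, like v1's `AnchorKit`, constructed by no one here); `blochAdjugate C ρ hF : Ext²(𝓕,𝓕) →+ H⁸(X(ℂ);ℂ)`,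
`ξ ↦ Σ_j c_{3−j}(𝓕) ∪ ρ(σ̃_j ξ)` built from the REAL `sigmaHigher`, v4's REAL `chernOne∕Two∕Three` and the REAL `cupProduct`; Newton in
degrees `1, 2, 3` under (A1@Z) (`chernOne∕Two∕Three_eq_of_ch_eq`) and the PENCIL FORM of `blochAdjugate` under (A1@Z)
(`blochAdjugate_eq_pencil_of_ch_eq`); the necessity theorem; `dualTensorPow`, `KoszulWindowAcyclic` (the window, with tensor powers
`(𝓕^∨)^{⊗j} ⊇ Λ^j 𝓕^∨` as a typable surrogate — STRONGER hypotheses, so the law below is WEAKER than (L5⁺)); and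
**`BlochAdjugateLaw C X ρ` — A NAMED STATEMENT (`Prop`), NEITHER PROVED NOR ASSERTED HERE** = (L5⁺)(1)+(2) on `X`: for a rank-`4` finite
locally free `𝓕` in the Koszul window and the zero scheme `i` of a section with `i` a regular immersion of codimension `4`,
`IsBlochSemiregular i (2·4) 4 ↔ Function.Injective (blochAdjugate C ρ hF)`.
§21.3 END TO END, GIVEN THE LAWS: `Design.seedCheck_of_zeroScheme_of_blochAdjugate`, `…_of_twistedKernelPresentation_of_blochAdjugate`
and `blochSeedDiscOne_of_zeroSchemes_of_blochAdjugate : … → BlochSeedDiscOne` BY NAME (through v4), with C7 REPLACED by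
«`blochAdjugate` injective» — a condition on `(𝓕, presentation data)` readable before `s` is chosen.
§21.4 THE JSON ↔ OBJECT DICTIONARY (v21.1): `Design.chernCoeff₁₂₃` (the design's Chern numbers `γ_k(D)`, Newton from `D.coeff`),
`blochAdjugate_eq_pencil_of_realisedBy` ∕ `…_of_twistedKernelPresentation` (for a realised ∕ kernel-presented design the adjugate trace IS
the Bloch pencil of the four cupped sigmas with coefficients `γ_k(D)` resp. `γ_k(D(t))`), `Design.coeff_zero_of_classData` (C0 ⟹ rank
coefficient `4`), `Design.coeff_one∕two∕three_tw`, `Design.chernCoeff_tw` (`γ_k(D(t))` = Chern numbers of a rank-`4` twist, from v4's PROVED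
`Design.tw_coeff`) and `Design.pencilCoeff_tw` (the json half of the E-form identity (L5⁺)(3): `Σ_{j≥i} γ_{3−j}(D(t))·C(j,i)(−t)^{j−i} =
v_{3−i}(t)`).

## Honest status

Nothing here is proved toward HC ∕ HC_CM ∕ HC_AV ∕ №4 ∕ 26512 ∕ 18881 ∕ H2. (L5⁺) is a PEN theorem resting on BF2003 Prop. 8.2 ∕ Lemma 8.4
and a cochain computation recorded in the g20 memo; in this file it is a HYPOTHESIS (`BlochAdjugateLaw`), exactly like v4's
`TopChernFourLocalisation` and v2's `TowerOverSeedLaw`. `HodgeToBetti` is data no one has constructed. Every `theorem` below is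
proved (linear algebra, bilinearity ∕ associativity of `∪`, repackaging). No `sorry`, no new axiom, no `instance`, no `notation`.
Iacono–Manetti (arXiv:1112.0425, Thm. 11.1) prove that `π_{Z(s)}` annihilates all obstructions of `Z(s)`; neither they nor BF §8
state the adjugate formula (2) — presearch in the memo.

[cite: BuchweitzFlenner2003, Prop. 8.2, Lemma 8.4, Def. 4.1] [cite: Bloch1972Semiregularity, §4–§6 (cite-only; via BF (8.1)–Prop. 8.2)]
[cite: Fulton1998, Example 3.2.3 and Example 14.1.1] [cite: HatcherAT2002, §3.2]
-/

noncomputable section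

open CategoryTheory CategoryTheory.Abelian AlgebraicGeometry
open Literature.AlgebraicGeometry Literature.AlgebraicGeometry.Modules Literature.AlgebraicGeometry.Motives
open Literature.AlgebraicGeometry.HodgeTheory
open Literature.AlgebraicTopology.SingularHomology

namespace Summit.HodgeConjecture.HodgeConjecture.Cruxes.BlochSeedDiscOne.SeedChecker

open Summit.HodgeConjecture.HodgeConjecture.Cruxes.BlochSeedDiscOne.Anchor
open Summit.Ventures.HSemireg Summit.Ventures.HSemireg.Pad4Tower

section VTwentyOne

/-! ### §21.1 The Bloch pencil — pure algebra -/

namespace BlochPencil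

section AddMonoidHomPencil

variable {R : Type*} [CommRing R] {V W : Type*} [AddCommGroup V] [AddCommGroup W] [Module R W]

/-- **THE BLOCH PENCIL** of four additive maps `f₀, f₁, f₂, f₃ : V →+ W` (intended: `f_j = h^{3−j} ∪ σ̃_j`, `σ̃_j = Tr(∗·At(𝓔)^j)` on
`V = Ext²(𝓔, 𝓔)`, `W = H^{3,5}`), with design Chern coefficients `γ₁, γ₂, γ₃` (`c_m(𝓔) = γ_m h^m`) at the twist `t`:
`Π_t = f₃ + v₁(t) f₂ + v₂(t) f₁ + v₃(t) f₀`, `v_k(t) = Σ_{m ≤ k} γ_m t^{k−m}` — by (L5⁺)(3) the Bloch semiregularity map of the zero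
locus of ANY regular section of `𝓔(tΘ)` in the Koszul window, precomposed with the Koszul isomorphism `Φ_s`. A DEFINITION (pure algebra).
[cite: BuchweitzFlenner2003, Prop. 8.2] -/
def pencil (f : Fin 4 → (V →+ W)) (γ₁ γ₂ γ₃ t : R) : V →+ W :=
  f 3 + (γ₁ + t) • f 2 + (γ₂ + γ₁ * t + t ^ 2) • f 1 + (γ₃ + γ₂ * t + γ₁ * t ^ 2 + t ^ 3) • f 0

theorem pencil_apply (f : Fin 4 → (V →+ W)) (γ₁ γ₂ γ₃ t : R) (x : V) :
    pencil f γ₁ γ₂ γ₃ t x =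
      f 3 x + (γ₁ + t) • f 2 x + (γ₂ + γ₁ * t + t ^ 2) • f 1 x + (γ₃ + γ₂ * t + γ₁ * t ^ 2 + t ^ 3) • f 0 x :=
  rfl

/-- **NECESSITY**: the joint kernel of `f₀, …, f₃` lies in the kernel of the pencil at EVERY twist … -/
theorem pencil_apply_eq_zero {f : Fin 4 → (V →+ W)} {x : V} (hx : ∀ j, f j x = 0) (γ₁ γ₂ γ₃ t : R) :
    pencil f γ₁ γ₂ γ₃ t x = 0 := by
  simp [pencil_apply, hx]

/-- … so an injective pencil (C7 at the lci door, by the law of §21.2) forces `f₀, …, f₃` to be JOINTLY injective (for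
`f_j = h^{3−j} ∪ σ̃_j` with `h^{3−j} ∪` injective on the relevant Hodge group: `{0,1,2,3}`-semiregularity of `𝓔`, the sheaf door's C7 in
the Koszul window `{1,2,3,4}`) — the sheaf check is NECESSARY for the lci check. -/
theorem eq_zero_of_pencil_injective {f : Fin 4 → (V →+ W)} {γ₁ γ₂ γ₃ t : R}
    (hinj : Function.Injective (pencil f γ₁ γ₂ γ₃ t)) {x : V} (hx : ∀ j, f j x = 0) : x = 0 :=
  hinj (by rw [pencil_apply_eq_zero hx, map_zero])

/-- **on the joint kernel of the LOWER maps `f₀, f₁, f₂` the pencil IS `f₃`** (= `σ̃₃`: g16's conjectural (L5) «`π ≐ σ₃`» holds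
exactly there, at every twist). -/
theorem pencil_apply_of_lower_eq_zero {f : Fin 4 → (V →+ W)} {x : V} (h0 : f 0 x = 0) (h1 : f 1 x = 0)
    (h2 : f 2 x = 0) (γ₁ γ₂ γ₃ t : R) : pencil f γ₁ γ₂ γ₃ t x = f 3 x := by
  simp [pencil_apply, h0, h1, h2]

/-- **the untwisted pencil** `Π₀ = f₃ + γ₁ f₂ + γ₂ f₁ + γ₃ f₀` (= `D_ξ c₄(𝓔)`, the polarised top Chern class). -/
theorem pencil_zero_twist (f : Fin 4 → (V →+ W)) (γ₁ γ₂ γ₃ : R) :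
    pencil f γ₁ γ₂ γ₃ 0 = f 3 + γ₁ • f 2 + γ₂ • f 1 + γ₃ • f 0 := by
  simp [pencil]

/-- the pencil coefficients obey `v_{k+1}(t) = γ_{k+1} + t·v_k(t)` — `c(𝓔 − 𝒪(−tΘ)) = c(𝓔)·(1 − t h)⁻¹`; recorded as the three
identities between the literal coefficients of `pencil`. [`ring`] -/
theorem coeff_recursion (γ₁ γ₂ γ₃ t : R) :
    γ₁ + t = γ₁ + t * 1 ∧ γ₂ + γ₁ * t + t ^ 2 = γ₂ + t * (γ₁ + t) ∧
      γ₃ + γ₂ * t + γ₁ * t ^ 2 + t ^ 3 = γ₃ + t * (γ₂ + γ₁ * t + t ^ 2) := by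
  refine ⟨by ring, by ring, by ring⟩

end AddMonoidHomPencil

section LinearPencil

variable {K : Type*} [Field K] {V W : Type*} [AddCommGroup V] [Module K V] [AddCommGroup W] [Module K W]

/-- the same pencil on `K`-LINEAR maps (for dimension counts). -/
def pencilₗ (f : Fin 4 → (V →ₗ[K] W)) (γ₁ γ₂ γ₃ t : K) : V →ₗ[K] W :=
  f 3 + (γ₁ + t) • f 2 + (γ₂ + γ₁ * t + t ^ 2) • f 1 + (γ₃ + γ₂ * t + γ₁ * t ^ 2 + t ^ 3) • f 0

theorem pencilₗ_apply (f : Fin 4 → (V →ₗ[K] W)) (γ₁ γ₂ γ₃ t : K) (x : V) :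
    pencilₗ f γ₁ γ₂ γ₃ t x =
      f 3 x + (γ₁ + t) • f 2 x + (γ₂ + γ₁ * t + t ^ 2) • f 1 x + (γ₃ + γ₂ * t + γ₁ * t ^ 2 + t ^ 3) • f 0 x :=
  rfl

/-- the linear pencil IS the additive pencil of the underlying additive maps. -/
theorem toAddMonoidHom_pencilₗ (f : Fin 4 → (V →ₗ[K] W)) (γ₁ γ₂ γ₃ t : K) :
    (pencilₗ f γ₁ γ₂ γ₃ t).toAddMonoidHom = pencil (fun j => (f j).toAddMonoidHom) γ₁ γ₂ γ₃ t :=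
  rfl

/-- **THE LCI-DOOR BUDGET**: an injective pencil forces `dim V ≤ dim W` — with `V = Ext²(𝓔, 𝓔)`, `W = H⁵(S⁴, Ω³)`:
`ext²(𝓔, 𝓔) ≤ h^{3,5}(S⁴) = 3136` for every design that can pass C7 at the lci door, at any twist, for any section (R19.365's
«door-dead by count», now a consequence of the Koszul isomorphism alone). [Mathlib `LinearMap.finrank_le_finrank_of_injective`] -/
theorem finrank_le_of_pencilₗ_injective [FiniteDimensional K W] {f : Fin 4 → (V →ₗ[K] W)} {γ₁ γ₂ γ₃ t : K}
    (hinj : Function.Injective (pencilₗ f γ₁ γ₂ γ₃ t)) : Module.finrank K V ≤ Module.finrank K W :=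
  LinearMap.finrank_le_finrank_of_injective hinj

/-- contrapositive: `dim W < dim V` ⟹ the pencil is not injective at ANY twist. -/
theorem not_pencilₗ_injective_of_finrank_lt [FiniteDimensional K W] (f : Fin 4 → (V →ₗ[K] W)) (γ₁ γ₂ γ₃ t : K)
    (hlt : Module.finrank K W < Module.finrank K V) : ¬ Function.Injective (pencilₗ f γ₁ γ₂ γ₃ t) :=
  fun hinj => lt_irrefl _ (hlt.trans_le (finrank_le_of_pencilₗ_injective hinj))

/-- `h^{3,5}` of an abelian `8`-fold: `C(8,3)·C(8,5) = 3136` (the number v6.2 calls `lciDoorBudget`; restated, v6.2 not being importable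
here). [`decide`] -/
theorem hodgeNumber_three_five_abelian_eightfold : Nat.choose 8 3 * Nat.choose 8 5 = 3136 := by decide

end LinearPencil

end BlochPencil

/-! ### §21.2 The object side: the adjugate Atiyah trace on honest carriers, the Koszul window, the law -/

section ObjectSide

/-- **`(c·x)ⁱ = cⁱ·xⁱ`** for a degree-`2` class (bilinearity of `∪`). [cite: HatcherAT2002, §3.2] -/
theorem cupPowTwo_smul_eq_pow_smul {Y : Type} [TopologicalSpace Y] (c : ℂ) (x : singularCohomology ℂ ℂ Y 2) (i : ℕ) :
    cupPowTwo (c • x) i = c ^ i • cupPowTwo x i := by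
  induction i with
  | zero => simp
  | succ i ih =>
    rw [cupPowTwo_succ, cupPowTwo_succ, ih, LinearMap.map_smul₂, LinearMap.map_smul, smul_smul, ← pow_succ]

/-- **A HODGE-TO-BETTI REALISATION** of the REAL Hodge cohomology groups of a complex scheme `X`: injective additive maps
`H^b(X, Ω^a_{X∕ℂ}) ↪ H^{a+b}(X(ℂ); ℂ)` (intended instance, `X` smooth projective: Dolbeault `H^b(X, Ω^a) = H^{a,b}` followed by the
Hodge decomposition `H^{a,b} ⊂ H^{a+b}(X(ℂ); ℂ)` — Hodge theory + GAGA). A STRUCTURE, i.e. DATA, constructed by no one in this file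
(the tree's `HodgeRealization` is the same idea for abstract `ℂ`-vector spaces `H i j`; the real `hodgeCohomology` carries no
`ℂ`-module structure, whence `→+`). [cite: Voisin2002, Thm. 6.18 and Cor. 6.12 (Hodge decomposition; cite-only)] -/
structure HodgeToBetti (X : Motives.SchemeOver ℂ) where
  /-- `H^b(X, Ω^a) → H^{a+b}(X(ℂ); ℂ)` -/
  toBetti (a b : ℕ) {m : ℕ} (h : a + b = m) : hodgeCohomology X a b →+ complexBetti X m
  injective_toBetti (a b : ℕ) {m : ℕ} (h : a + b = m) : Function.Injective (toBetti a b h)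

variable (C : ChernCharacterBetti) {X : Motives.SchemeOver ℂ} (ρ : HodgeToBetti X) {𝓕 : X.left.Modules}
  (hF : IsFiniteLocallyFree 𝓕)

/-- the `j`-th CUPPED SIGMA against a class `c ∈ H^{2k}`: `ξ ↦ c ∪ ρ(σ̃_j ξ) ∈ H⁸(X(ℂ); ℂ)` (`σ̃_j = sigmaHigher hF j`, REAL). -/
def cupSigma (j : ℕ) {k : ℕ} (c : complexBetti X (2 * k)) (hk : 2 * k + 2 * (j + 1) = 2 * 4) :
    Ext 𝓕 𝓕 2 →+ complexBetti X (2 * 4) :=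
  (cupProduct hk c).toAddMonoidHom.comp
    ((ρ.toBetti j (j + 2) (by omega : j + (j + 2) = 2 * (j + 1))).comp (sigmaHigher hF j))

theorem cupSigma_apply (j : ℕ) {k : ℕ} (c : complexBetti X (2 * k)) (hk : 2 * k + 2 * (j + 1) = 2 * 4) (x : Ext 𝓕 𝓕 2) :
    cupSigma ρ hF j c hk x = cupProduct hk c (ρ.toBetti j (j + 2) (by omega) (sigmaHigher hF j x)) :=
  rfl

/-- `cupSigma` is `ℂ`-linear in the class `c`. -/
theorem cupSigma_smul (j : ℕ) {k : ℕ} (a : ℂ) (c : complexBetti X (2 * k)) (hk : 2 * k + 2 * (j + 1) = 2 * 4) :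
    cupSigma ρ hF j (a • c) hk = a • cupSigma ρ hF j c hk := by
  ext x
  change cupProduct hk (a • c) _ = a • cupProduct hk c _
  rw [LinearMap.map_smul₂]

/-- the top sigma realised in `H⁸`: `ξ ↦ ρ(σ̃₃ ξ)` (`c₀ = 1`). -/
def sigmaThreeBetti : Ext 𝓕 𝓕 2 →+ complexBetti X (2 * 4) :=
  (ρ.toBetti 3 (3 + 2) (by norm_num : 3 + (3 + 2) = 2 * 4)).comp (sigmaHigher hF 3)

/-- **THE ADJUGATE ATIYAH TRACE `ξ ↦ Tr(ξ · adj At(𝓕)) = Σ_{j=0}^{3} c_{3−j}(𝓕) ∪ σ̃_j(ξ)`** on `Ext²(𝓕, 𝓕)`, valued in `H⁸(X(ℂ); ℂ)`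
— v4's REAL Newton classes `chernThree ∕ chernTwo ∕ chernOne` of the Chern character theory `C`, the REAL `sigmaHigher`, the REAL
`cupProduct`, and the realisation `ρ`. By (L5⁺)(2) this is (up to sign and the Koszul isomorphism `Φ_s`) Bloch's semiregularity map
of the zero scheme of every regular section of `𝓕` in the Koszul window. A DEFINITION. [cite: BuchweitzFlenner2003, Prop. 8.2 and Def. 4.1] -/
def blochAdjugate : Ext 𝓕 𝓕 2 →+ complexBetti X (2 * 4) :=
  cupSigma ρ hF 0 (chernThree C X 𝓕) (by norm_num) + cupSigma ρ hF 1 (chernTwo C X 𝓕) (by norm_num) +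
    cupSigma ρ hF 2 (chernOne C X 𝓕) (by norm_num) + sigmaThreeBetti ρ hF

theorem blochAdjugate_apply (x : Ext 𝓕 𝓕 2) :
    blochAdjugate C ρ hF x =
      cupSigma ρ hF 0 (chernThree C X 𝓕) (by norm_num) x + cupSigma ρ hF 1 (chernTwo C X 𝓕) (by norm_num) x +
        cupSigma ρ hF 2 (chernOne C X 𝓕) (by norm_num) x + sigmaThreeBetti ρ hF x :=
  rfl

/-- **NECESSITY ON REAL CARRIERS**: if the adjugate trace is injective then `𝓕` is Buchweitz–Flenner `{0,1,2,3}`-semiregular — i.e.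
`I`-semiregular for the sheaf door's Koszul window `I = {1,2,3,4}` read as `{q' | q'+1 ∈ I}` (v1 `Design.SheafSeedCheck`'s C7). So, GIVEN
the law, lci-door C7 of a zero locus ⟹ sheaf-door C7 of the bundle: the sheaf check is the cheaper NECESSARY screen. -/
theorem isISemiregular_of_blochAdjugate_injective (hinj : Function.Injective (blochAdjugate C ρ hF)) :
    IsISemiregular hF {q' | q' + 1 ∈ koszulWindow} := by
  intro x hx
  have h0 : sigmaHigher hF 0 x = 0 := hx 0 (by decide)
  have h1 : sigmaHigher hF 1 x = 0 := hx 1 (by decide)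
  have h2 : sigmaHigher hF 2 x = 0 := hx 2 (by decide)
  have h3 : sigmaHigher hF 3 x = 0 := hx 3 (by decide)
  apply hinj
  rw [map_zero, blochAdjugate_apply, cupSigma_apply, cupSigma_apply, cupSigma_apply, h0, h1, h2]
  simp [sigmaThreeBetti, h3]

/-! #### Newton in degrees `1, 2, 3` under (A1@Z), and the pencil form of the adjugate trace -/

variable {C}

/-- `c₁ = a₁·h` if `ch₁ = a₁·h¹`. [cite: Fulton1998, Example 3.2.3] -/
theorem chernOne_eq_of_ch_eq {h : complexBetti X 2} {a₁ : ℂ} (h1 : C.ch X 𝓕 1 = a₁ • cupPowTwo h 1) :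
    chernOne C X 𝓕 = a₁ • cupPowTwo h 1 :=
  h1

/-- `c₂ = (a₁²∕2 − a₂)·h²` if `ch₁ = a₁·h`, `ch₂ = a₂·h²`. [cite: Fulton1998, Example 3.2.3] -/
theorem chernTwo_eq_of_ch_eq {h : complexBetti X 2} {a₁ a₂ : ℂ} (h1 : C.ch X 𝓕 1 = a₁ • cupPowTwo h 1)
    (h2 : C.ch X 𝓕 2 = a₂ • cupPowTwo h 2) : chernTwo C X 𝓕 = (a₁ ^ 2 / 2 - a₂) • cupPowTwo h 2 := by
  have e1 : C.ch X 𝓕 1 = a₁ • h := by rw [h1, cupPowTwo_one]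
  simp only [chernTwo, e1, h2, cupPowTwo_smul_eq_pow_smul, smul_smul]
  module

/-- `c₃ = (a₁³∕6 − a₁a₂ + 2a₃)·h³` if `ch_p = a_p·h^p`, `p ≤ 3`. [cite: Fulton1998, Example 3.2.3] -/
theorem chernThree_eq_of_ch_eq {h : complexBetti X 2} {a₁ a₂ a₃ : ℂ} (h1 : C.ch X 𝓕 1 = a₁ • cupPowTwo h 1)
    (h2 : C.ch X 𝓕 2 = a₂ • cupPowTwo h 2) (h3 : C.ch X 𝓕 3 = a₃ • cupPowTwo h 3) :
    chernThree C X 𝓕 = (a₁ ^ 3 / 6 - a₁ * a₂ + 2 * a₃) • cupPowTwo h 3 := by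
  have e1 : C.ch X 𝓕 1 = a₁ • h := by rw [h1, cupPowTwo_one]
  have p12 : cupProduct (rfl : 2 * 1 + 2 * 2 = 2 * 3) h (cupPowTwo h 2) = cupPowTwo h 3 := by
    have e := cupProduct_cupPowTwo_cupPowTwo h 1 2 rfl
    rwa [cupPowTwo_one] at e
  simp only [chernThree, e1, h2, h3, cupPowTwo_smul_eq_pow_smul, map_smul, LinearMap.smul_apply, smul_smul, p12]
  module

/-- the four `h`-CUPPED SIGMAS `f_j = h^{3−j} ∪ ρ(σ̃_j)` (`j = 0, 1, 2`) and `f₃ = ρ(σ̃₃)` — the `f` of `BlochPencil.pencil`. -/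
def hCuppedSigma (h : complexBetti X 2) : Fin 4 → (Ext 𝓕 𝓕 2 →+ complexBetti X (2 * 4)) :=
  ![cupSigma ρ hF 0 (cupPowTwo h 3) (by norm_num), cupSigma ρ hF 1 (cupPowTwo h 2) (by norm_num),
    cupSigma ρ hF 2 (cupPowTwo h 1) (by norm_num), sigmaThreeBetti ρ hF]

/-- **THE PENCIL FORM OF THE ADJUGATE TRACE UNDER (A1)-CLEANLINESS** (`ch_p(𝓕) = a_p·h^p`, `p = 1, 2, 3` — the clauses of v1's
`CleanAtSeed` in the Koszul window): `blochAdjugate = BlochPencil.pencil (hCuppedSigma h) c₁ c₂ c₃ 0` with the Chern coefficients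
`c₁ = a₁`, `c₂ = a₁²∕2 − a₂`, `c₃ = a₁³∕6 − a₁a₂ + 2a₃` OF `𝓕` ITSELF (for `𝓕 = 𝓔(tH)` presenting the twisted design `D(t)`: the
coefficients of `D(t)`; equivalently, by (L5⁺)(3), `pencil (σ̃^{𝓔}-version) γ₁ γ₂ γ₃ t` — a rewriting this file does not need). -/
theorem blochAdjugate_eq_pencil_of_ch_eq {h : complexBetti X 2} {a₁ a₂ a₃ : ℂ} (h1 : C.ch X 𝓕 1 = a₁ • cupPowTwo h 1)
    (h2 : C.ch X 𝓕 2 = a₂ • cupPowTwo h 2) (h3 : C.ch X 𝓕 3 = a₃ • cupPowTwo h 3) :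
    blochAdjugate C ρ hF =
      BlochPencil.pencil (hCuppedSigma ρ hF h) a₁ (a₁ ^ 2 / 2 - a₂) (a₁ ^ 3 / 6 - a₁ * a₂ + 2 * a₃) 0 := by
  rw [BlochPencil.pencil_zero_twist, blochAdjugate, chernOne_eq_of_ch_eq h1, chernTwo_eq_of_ch_eq h1 h2,
    chernThree_eq_of_ch_eq h1 h2 h3, cupSigma_smul, cupSigma_smul, cupSigma_smul]
  simp only [hCuppedSigma, Matrix.cons_val_zero, Matrix.cons_val_one, Matrix.cons_val]
  abel

variable {E₀ : AbelianVariety ℂ} {ψ₀ : E₀ ⟶ E₀}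

/-- … in particular under v1's (A1@Z) `CleanAtSeed C I F h 𝓕 μ` on the anchor with `1, 2, 3 ∈ I`: the adjugate trace IS an `h`-pencil
with RATIONAL coefficients (the Chern coefficients of the realised bundle). -/
theorem blochAdjugate_eq_pencil_of_cleanAtSeed (ρ : HodgeToBetti (pad4Anchor E₀).X) {I : Finset ℕ} {F : WeilFrame E₀ ψ₀}
    {h : complexBetti (pad4Anchor E₀).X 2} {𝓕 : (pad4Anchor E₀).X.left.Modules} (hF : IsFiniteLocallyFree 𝓕) {μ : GaussianInt}
    (hcl : CleanAtSeed C I F h 𝓕 μ) (h1 : 1 ∈ I) (h2 : 2 ∈ I) (h3 : 3 ∈ I) :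
    ∃ c₁ c₂ c₃ : ℚ, blochAdjugate C ρ hF =
      BlochPencil.pencil (hCuppedSigma ρ hF h) ((c₁ : ℚ) : ℂ) ((c₂ : ℚ) : ℂ) ((c₃ : ℚ) : ℂ) 0 := by
  obtain ⟨c, q, hc, -⟩ := hcl
  refine ⟨c 1, c 1 ^ 2 / 2 - c 2, c 1 ^ 3 / 6 - c 1 * c 2 + 2 * c 3, ?_⟩
  rw [blochAdjugate_eq_pencil_of_ch_eq ρ hF (hc 1 h1 (by decide)) (hc 2 h2 (by decide)) (hc 3 h3 (by decide))]
  push_cast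
  rfl

/-! #### The Koszul window and the law -/

/-- the `j`-fold tensor power `(𝓕^∨)^{⊗ j}` of the dual `𝓕^∨ = 𝓗om(𝓕, 𝒪_X)` (`(𝓕^∨)^{⊗0} = 𝒪_X`), on the tree's `Modules.tensorObj`,
`Modules.sheafHom`, `Modules.unitModule`. -/
def dualTensorPow {Y : Scheme.{0}} (𝓕 : Y.Modules) : ℕ → Y.Modules
  | 0 => Modules.unitModule Y
  | j + 1 => Modules.tensorObj (dualTensorPow 𝓕 j) (Modules.sheafHom 𝓕 (Modules.unitModule Y))

/-- **THE KOSZUL WINDOW** for a rank-`4` bundle `𝓕` on an `8`-fold: `H¹(𝓕) = H²(𝓕) = 0` and `H^q(𝓕 ⊗ (𝓕^∨)^{⊗j}) = 0` for `2 ≤ j ≤ 4`,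
`j ≤ q ≤ j + 1` — the vanishings under which the Koszul spectral sequence gives `Φ_s : H²(𝓔nd 𝓕) ⥲ H¹(Z(s), 𝒩)` for every regular
section ((L5⁺)(1)); typed with TENSOR powers (`Λ^j 𝓕^∨` is a direct summand of `(𝓕^∨)^{⊗j}` in characteristic `0`, and the tree has
no exterior powers of `𝒪_X`-modules), hence STRONGER than needed. For `𝓕 = 𝓔(tΘ)` every clause holds for `t ≫ 0` (Serre vanishing +
duality: the twists `(1−j)t ≤ −t` are negative and `q ≤ 5 < 8`). Real carriers: `moduleSheafCohomology`. -/
def KoszulWindowAcyclic {Y : Scheme.{0}} (𝓕 : Y.Modules) : Prop :=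
  Subsingleton (moduleSheafCohomology 𝓕 1) ∧ Subsingleton (moduleSheafCohomology 𝓕 2) ∧
    ∀ j q : ℕ, 2 ≤ j → j ≤ 4 → j ≤ q → q ≤ j + 1 →
      Subsingleton (moduleSheafCohomology (Modules.tensorObj 𝓕 (dualTensorPow 𝓕 j)) q)

variable (C)

/-- **THE BLOCH ADJUGATE LAW on `X` — A NAMED STATEMENT (`Prop`), NEITHER PROVED NOR ASSERTED HERE** (consumed as
`(hlaw : BlochAdjugateLaw C X ρ)`; intended `X` = the anchor `S⁴`, smooth projective of dimension `8`): for every finite locally free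
`𝓕` of rank `4` in the Koszul window and every section `s` whose zero scheme `i : Z ↪ X` is a regular immersion of codimension `4`,
**`Z` is Bloch-semiregular in the `8`-fold iff the adjugate Atiyah trace `ξ ↦ Σ_j c_{3−j}(𝓕) ∪ ρ(σ̃_j ξ)` is injective on `Ext²(𝓕, 𝓕)`**
— (L5⁺)(1)+(2): `Φ_s` is an isomorphism onto `H¹(Z, 𝒩)` and `π_Z ∘ Φ_s = ± ρ ∘ (adjugate trace)` with `ρ` injective. The right-hand
side does not mention `s`: C7 becomes a check on (design, presentation). [cite: BuchweitzFlenner2003, Prop. 8.2, Lemma 8.4]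
[cite: Bloch1972Semiregularity, §4–§6 (cite-only; via BF (8.1)–Prop. 8.2)] -/
def BlochAdjugateLaw (X : Motives.SchemeOver ℂ) (ρ : HodgeToBetti X) : Prop :=
  ∀ (𝓕 : X.left.Modules) (hF : IsFiniteLocallyFree 𝓕), HasRank 𝓕 4 → KoszulWindowAcyclic 𝓕 →
    ∀ (s : Modules.unitModule X.left ⟶ 𝓕) ⦃Z : Scheme.{0}⦄ (i : Z ⟶ X.left), IsZeroSchemeOf s i →
      IsRegularImmersionOfCodim i 4 → (IsBlochSemiregular i (2 * 4) 4 ↔ Function.Injective (blochAdjugate C ρ hF))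

variable {C ρ}

/-- how the law is consumed: an injective adjugate trace makes the zero scheme of every admissible section Bloch-semiregular. -/
theorem isBlochSemiregular_of_blochAdjugateLaw (hlaw : BlochAdjugateLaw C X ρ) (hrk : HasRank 𝓕 4)
    (hK : KoszulWindowAcyclic 𝓕) (s : Modules.unitModule X.left ⟶ 𝓕) {Z : Scheme.{0}} {i : Z ⟶ X.left}
    (hZ : IsZeroSchemeOf s i) (hreg : IsRegularImmersionOfCodim i 4) (hinj : Function.Injective (blochAdjugate C ρ hF)) :
    IsBlochSemiregular i (2 * 4) 4 :=
  (hlaw 𝓕 hF hrk hK s i hZ hreg).2 hinj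

/-- … and conversely a Bloch-semiregular zero scheme of ONE admissible section certifies the adjugate trace injective (so every other
admissible section's zero scheme is semiregular too: C7 is a property of `𝓕`). -/
theorem blochAdjugate_injective_of_isBlochSemiregular (hlaw : BlochAdjugateLaw C X ρ) (hrk : HasRank 𝓕 4)
    (hK : KoszulWindowAcyclic 𝓕) (s : Modules.unitModule X.left ⟶ 𝓕) {Z : Scheme.{0}} {i : Z ⟶ X.left}
    (hZ : IsZeroSchemeOf s i) (hreg : IsRegularImmersionOfCodim i 4) (hsr : IsBlochSemiregular i (2 * 4) 4) :
    Function.Injective (blochAdjugate C ρ hF) :=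
  (hlaw 𝓕 hF hrk hK s i hZ hreg).1 hsr

end ObjectSide

/-! ### §21.3 The lci door end to end, C7 replaced by «adjugate trace injective» -/

section EndToEnd

variable {E₀ : AbelianVariety ℂ} {ψ₀ : E₀ ⟶ E₀} {C : ChernCharacterBetti}

/-- **THE LCI DOOR FROM A ZERO SCHEME, C7 READ ON THE BUNDLE** — GIVEN both laws (`TopChernFourLocalisation`, `BlochAdjugateLaw`): a
design `D` passing C0, a rank-`4` bundle `𝓕` on the anchor, (A1)-clean at the seed with the design's `μ` in a window `⊇ {1,2,3}`, in the
Koszul window, WITH INJECTIVE ADJUGATE TRACE, and a section `s` whose zero scheme `i : Z ↪ S⁴` passes C5 (regular immersion of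
codimension `4`) and C6 (integral, codimension `≥ 4` pointwise) ⟹ `D.SeedCheck K i q` for some `q`. C7 is no longer a hypothesis on `Z`. -/
theorem Design.seedCheck_of_zeroScheme_of_blochAdjugate (hE : E₀.dim = 1) (hψ : ψ₀ ≫ ψ₀ = -(1 • 𝟙 E₀)) {D : Design}
    (hC0 : D.ClassData) (K : AnchorKit E₀ ψ₀) {I : Finset ℕ} {𝓕 : (pad4Anchor E₀).X.left.Modules}
    (hloc : TopChernFourLocalisation C) {ρ : HodgeToBetti (pad4Anchor E₀).X} (hlaw : BlochAdjugateLaw C (pad4Anchor E₀).X ρ)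
    (hF : IsFiniteLocallyFree 𝓕) (hrk : HasRank 𝓕 4) (hK : KoszulWindowAcyclic 𝓕)
    (hcl : CleanAtSeed C I K.F (hStd E₀ K.η) 𝓕 D.mu) (h1 : 1 ∈ I) (h2 : 2 ∈ I) (h3 : 3 ∈ I)
    (hinj : Function.Injective (blochAdjugate C ρ hF)) (s : Modules.unitModule (pad4Anchor E₀).X.left ⟶ 𝓕) {Z : Scheme.{0}}
    {i : Z ⟶ (pad4Anchor E₀).X.left} (hZ : IsZeroSchemeOf s i) (hreg : IsRegularImmersionOfCodim i 4)
    (hint : AlgebraicGeometry.IsIntegral Z) (hcoh : ∀ z ∈ Set.range i.base, ((4 : ℕ) : ℕ∞) ≤ Order.coheight z) :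
    ∃ q : ℚ, D.SeedCheck K i q :=
  D.seedCheck_of_zeroScheme hE hψ hC0 K hloc hrk hcl h1 h2 h3 s hZ hreg hint hcoh
    (isBlochSemiregular_of_blochAdjugateLaw hF hlaw hrk hK s hZ hreg hinj)

/-- **THE TWISTED KERNEL ROUTE, C7 READ ON THE BUNDLE**: `𝓕 ≅ ker(𝓝 ↠ 𝓟)` presents the twisted design `D(t)` through a linked word frame
(so `𝓕` plays `𝓔(tH)`), has rank `4`, lies in the Koszul window and has injective adjugate trace; `s` is a section whose zero scheme
passes C5, C6 ⟹ `D.SeedCheck K i q`. The remaining MATHEMATICS: the display maps, rank `4`, the window at the chosen `t`, injectivity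
of ONE explicit map `Ext²(𝓕,𝓕) → H⁸` (computable from the presentation), a section with regular ∕ integral zero scheme — and the laws. -/
theorem Design.seedCheck_of_twistedKernelPresentation_of_blochAdjugate (hE : E₀.dim = 1) (hψ : ψ₀ ≫ ψ₀ = -(1 • 𝟙 E₀))
    {D : Design} (hC0 : D.ClassData) (K : AnchorKit E₀ ψ₀) {Φ : WordFrame E₀} (hΦ : Φ.LinksTo K.F (hStd E₀ K.η)) (t : ℤ)
    {𝓕 : (pad4Anchor E₀).X.left.Modules} (π : KernelPresentation C Φ (D.tw t) 𝓕) (hloc : TopChernFourLocalisation C)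
    {ρ : HodgeToBetti (pad4Anchor E₀).X} (hlaw : BlochAdjugateLaw C (pad4Anchor E₀).X ρ) (hF : IsFiniteLocallyFree 𝓕)
    (hrk : HasRank 𝓕 4) (hK : KoszulWindowAcyclic 𝓕) (hinj : Function.Injective (blochAdjugate C ρ hF))
    (s : Modules.unitModule (pad4Anchor E₀).X.left ⟶ 𝓕) {Z : Scheme.{0}} {i : Z ⟶ (pad4Anchor E₀).X.left}
    (hZ : IsZeroSchemeOf s i) (hreg : IsRegularImmersionOfCodim i 4) (hint : AlgebraicGeometry.IsIntegral Z)
    (hcoh : ∀ z ∈ Set.range i.base, ((4 : ℕ) : ℕ∞) ≤ Order.coheight z) : ∃ q : ℚ, D.SeedCheck K i q :=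
  D.seedCheck_of_twistedKernelPresentation hE hψ hC0 K hΦ t π hloc hrk s hZ hreg hint hcoh
    (isBlochSemiregular_of_blochAdjugateLaw hF hlaw hrk hK s hZ hreg hinj)

/-- **… so such data on EVERY CM anchor give the crux `BlochSeedDiscOne` BY NAME** (hypothesis-carrying; through v4's
`blochSeedDiscOne_of_zeroSchemes`). Nothing is asserted: no bundle, realisation, section or zero scheme is constructed in this file, and
both laws are hypotheses. -/
theorem blochSeedDiscOne_of_zeroSchemes_of_blochAdjugate (hloc : TopChernFourLocalisation C)
    (h : ∀ (E₀ : AbelianVariety ℂ) (ψ₀ : E₀ ⟶ E₀), E₀.dim = 1 → ψ₀ ≫ ψ₀ = -(1 • 𝟙 E₀) →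
      ∃ (ρ : HodgeToBetti (pad4Anchor E₀).X) (_ : BlochAdjugateLaw C (pad4Anchor E₀).X ρ) (D : Design) (_ : D.ClassData)
        (K : AnchorKit E₀ ψ₀) (I : Finset ℕ) (_ : 1 ∈ I) (_ : 2 ∈ I) (_ : 3 ∈ I) (𝓕 : (pad4Anchor E₀).X.left.Modules)
        (hF : IsFiniteLocallyFree 𝓕) (_ : HasRank 𝓕 4) (_ : KoszulWindowAcyclic 𝓕)
        (_ : CleanAtSeed C I K.F (hStd E₀ K.η) 𝓕 D.mu) (_ : Function.Injective (blochAdjugate C ρ hF))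
        (s : Modules.unitModule (pad4Anchor E₀).X.left ⟶ 𝓕) (Z : Scheme.{0}) (i : Z ⟶ (pad4Anchor E₀).X.left),
        IsZeroSchemeOf s i ∧ IsRegularImmersionOfCodim i 4 ∧ AlgebraicGeometry.IsIntegral Z ∧
          ∀ z ∈ Set.range i.base, ((4 : ℕ) : ℕ∞) ≤ Order.coheight z) :
    Summit.HodgeConjecture.HodgeConjecture.Theses.EightfoldBlochSeeds.BlochSeedDiscOne :=
  blochSeedDiscOne_of_zeroSchemes hloc fun E₀ ψ₀ hE hψ => by
    obtain ⟨ρ, hlaw, D, hC0, K, I, h1, h2, h3, 𝓕, hF, hrk, hK, hcl, hinj, s, Z, i, hZ, hreg, hint, hcoh⟩ := h E₀ ψ₀ hE hψ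
    exact ⟨D, hC0, K, I, h1, h2, h3, 𝓕, hrk, hcl, s, Z, i, hZ, hreg, hint, hcoh,
      isBlochSemiregular_of_blochAdjugateLaw hF hlaw hrk hK s hZ hreg hinj⟩

end EndToEnd

/-! ### §21.4 The json ↔ object dictionary for C7 — the pencil coefficients READ OFF THE DESIGN

For a REALISED design (`Design.RealisedBy`: `ch_p(𝓕) = (D.coeff p ∕ p!)·h^p` off degree `4`) the adjugate trace IS the Bloch pencil of the
four cupped sigmas `hCuppedSigma ρ hF h` (object side: presentation + `ρ`) with coefficients the design's CHERN numbers
`γ₁(D), γ₂(D), γ₃(D) ∈ ℚ` (json side: Newton from `D.coeff p = p!·ch_p`). For the twisted kernel route the design is `D(t)`, and for a clean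
rank-`4` design `γ_k(D(t))` are the Chern numbers of a twist — `γ₁ + 4t`, `γ₂ + 3γ₁t + 6t²`, `γ₃ + 2γ₂t + 3γ₁t² + 4t³`
(`= Σ_m C(4−m, k−m) γ_m t^{k−m}`, the `c_k(𝓕)` of (L5⁺)(3)) — typed from v4's PROVED `Design.tw_coeff`. So the C7 check of the lci door is:
three rationals from the json, four maps from the presentation, one rank computation (given the law). -/
section JsonObject

/-- `γ₁(D) = c₁(D)`: `c₁(𝓕) = γ₁ h` for a realised design. -/
def Design.chernCoeff₁ (D : Design) : ℚ := (D.coeff 1 : ℚ)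

/-- `γ₂(D) = (c₁² − D.coeff 2) ∕ 2` (`c₂ = c₁²∕2 − ch₂`). -/
def Design.chernCoeff₂ (D : Design) : ℚ := ((D.coeff 1 : ℚ) ^ 2 - (D.coeff 2 : ℚ)) / 2

/-- `γ₃(D) = c₁³∕6 − c₁·(D.coeff 2)∕2 + (D.coeff 3)∕3` (`c₃ = c₁³∕6 − c₁ ch₂ + 2 ch₃`). -/
def Design.chernCoeff₃ (D : Design) : ℚ :=
  (D.coeff 1 : ℚ) ^ 3 / 6 - (D.coeff 1 : ℚ) * (D.coeff 2 : ℚ) / 2 + (D.coeff 3 : ℚ) / 3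

variable {E₀ : AbelianVariety ℂ} {ψ₀ : E₀ ⟶ E₀} {C : ChernCharacterBetti} {D : Design} {F : WeilFrame E₀ ψ₀}
  {h : complexBetti (pad4Anchor E₀).X 2} {𝓕 : (pad4Anchor E₀).X.left.Modules}

theorem Design.RealisedBy.ch_one (hR : D.RealisedBy C F h 𝓕) :
    C.ch (pad4Anchor E₀).X 𝓕 1 = ((((D.coeff 1 : ℤ) : ℚ) : ℚ) : ℂ) • cupPowTwo h 1 := by
  have e : C.ch (pad4Anchor E₀).X 𝓕 1 = ((((D.coeff 1 : ℤ) : ℚ) / ((1 : ℕ).factorial : ℚ) : ℚ) : ℂ) • cupPowTwo h 1 :=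
    hR.2.1 ⟨1, by norm_num⟩ (by decide)
  rw [e]; norm_num

theorem Design.RealisedBy.ch_two (hR : D.RealisedBy C F h 𝓕) :
    C.ch (pad4Anchor E₀).X 𝓕 2 = ((((D.coeff 2 : ℤ) : ℚ) / 2 : ℚ) : ℂ) • cupPowTwo h 2 := by
  have e : C.ch (pad4Anchor E₀).X 𝓕 2 = ((((D.coeff 2 : ℤ) : ℚ) / ((2 : ℕ).factorial : ℚ) : ℚ) : ℂ) • cupPowTwo h 2 :=
    hR.2.1 ⟨2, by norm_num⟩ (by decide)
  rw [e]; norm_num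

theorem Design.RealisedBy.ch_three (hR : D.RealisedBy C F h 𝓕) :
    C.ch (pad4Anchor E₀).X 𝓕 3 = ((((D.coeff 3 : ℤ) : ℚ) / 6 : ℚ) : ℂ) • cupPowTwo h 3 := by
  have e : C.ch (pad4Anchor E₀).X 𝓕 3 = ((((D.coeff 3 : ℤ) : ℚ) / ((3 : ℕ).factorial : ℚ) : ℚ) : ℂ) • cupPowTwo h 3 :=
    hR.2.1 ⟨3, by norm_num⟩ (by decide)
  rw [e]; norm_num [Nat.factorial]

/-- **C7's map from (design json, presentation)**: for a realised design the adjugate trace is the Bloch pencil of the four cupped sigmas with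
the design's Chern numbers `γ₁(D), γ₂(D), γ₃(D)` as coefficients. -/
theorem blochAdjugate_eq_pencil_of_realisedBy (ρ : HodgeToBetti (pad4Anchor E₀).X) (hF : IsFiniteLocallyFree 𝓕)
    (hR : D.RealisedBy C F h 𝓕) :
    blochAdjugate C ρ hF =
      BlochPencil.pencil (hCuppedSigma ρ hF h) ((D.chernCoeff₁ : ℚ) : ℂ) ((D.chernCoeff₂ : ℚ) : ℂ) ((D.chernCoeff₃ : ℚ) : ℂ) 0 := by
  rw [blochAdjugate_eq_pencil_of_ch_eq ρ hF hR.ch_one hR.ch_two hR.ch_three]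
  simp only [Design.chernCoeff₁, Design.chernCoeff₂, Design.chernCoeff₃]
  push_cast
  ring_nf

/-- **The twisted kernel route's C7 map**: `𝓕 ≅ ker(𝓝 ↠ 𝓟)` presenting `D(t)` through a linked word frame ⟹ the adjugate trace of `𝓕` is
the pencil of its cupped sigmas with coefficients `γ_k(D(t))` — json numbers of the TWISTED design. -/
theorem blochAdjugate_eq_pencil_of_twistedKernelPresentation (ρ : HodgeToBetti (pad4Anchor E₀).X) (hD : D.Clean)
    (K : AnchorKit E₀ ψ₀) {Φ : WordFrame E₀} (hΦ : Φ.LinksTo K.F (hStd E₀ K.η)) (t : ℤ) (hF : IsFiniteLocallyFree 𝓕)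
    (π : KernelPresentation C Φ (D.tw t) 𝓕) :
    blochAdjugate C ρ hF =
      BlochPencil.pencil (hCuppedSigma ρ hF (hStd E₀ K.η)) (((D.tw t).chernCoeff₁ : ℚ) : ℂ) (((D.tw t).chernCoeff₂ : ℚ) : ℂ)
        (((D.tw t).chernCoeff₃ : ℚ) : ℂ) 0 :=
  blochAdjugate_eq_pencil_of_realisedBy ρ hF (π.realisedBy hΦ (D.tw_clean t hD))

/-! #### The Chern numbers of the twisted design (json side of (L5⁺)(3)) -/

theorem Design.coeff_zero_of_classData (hC0 : D.ClassData) : D.coeff 0 = 4 := by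
  have e := congrArg Zsqrtd.re (D.rank_eq_coeff.symm.trans hC0.2.2.1)
  simpa [Zsqrtd.re_intCast, Zsqrtd.re_ofNat] using e

private theorem fin9_val_three : ((3 : Fin 9) : ℕ) = 3 := rfl
private theorem fin8_succ_two : (Fin.succ (2 : Fin 8) : Fin 9) = 3 := rfl

theorem Design.coeff_one_tw (hD : D.Clean) (h0 : D.coeff 0 = 4) (t : ℤ) : (D.tw t).coeff 1 = D.coeff 1 + 4 * t := by
  rw [D.tw_coeff t hD 1]
  simp only [Fin.sum_univ_succ, Fin.sum_univ_zero, Fin.succ_zero_eq_one, Fin.succ_one_eq_two, fin8_succ_two, Fin.val_zero,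
    Fin.val_one, Fin.val_succ, h0]
  norm_num [Nat.choose]
  ring

theorem Design.coeff_two_tw (hD : D.Clean) (h0 : D.coeff 0 = 4) (t : ℤ) :
    (D.tw t).coeff 2 = D.coeff 2 + 2 * t * D.coeff 1 + 4 * t ^ 2 := by
  rw [D.tw_coeff t hD 2]
  simp only [Fin.sum_univ_succ, Fin.sum_univ_zero, Fin.succ_zero_eq_one, Fin.succ_one_eq_two, fin8_succ_two, Fin.val_zero,
    Fin.val_two, Fin.val_succ, h0]
  norm_num [Nat.choose]
  ring

theorem Design.coeff_three_tw (hD : D.Clean) (h0 : D.coeff 0 = 4) (t : ℤ) :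
    (D.tw t).coeff 3 = D.coeff 3 + 3 * t * D.coeff 2 + 3 * t ^ 2 * D.coeff 1 + 4 * t ^ 3 := by
  rw [D.tw_coeff t hD 3]
  simp only [Fin.sum_univ_succ, Fin.sum_univ_zero, Fin.succ_zero_eq_one, Fin.succ_one_eq_two, fin8_succ_two, Fin.val_zero,
    fin9_val_three, Fin.val_succ, h0]
  norm_num [Nat.choose]
  ring

/-- **`γ_k(D(t))` = the Chern numbers of a rank-`4` twist**: `γ₁(t) = γ₁ + 4t`, `γ₂(t) = γ₂ + 3γ₁t + 6t²`,
`γ₃(t) = γ₃ + 2γ₂t + 3γ₁t² + 4t³` — the coefficients `c_{3−j}(𝓕)`, `𝓕 = 𝓔(tH)`, of the F-form of (L5⁺)(2), computed on the json side. -/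
theorem Design.chernCoeff_tw (hD : D.Clean) (h0 : D.coeff 0 = 4) (t : ℤ) :
    (D.tw t).chernCoeff₁ = D.chernCoeff₁ + 4 * t ∧
      (D.tw t).chernCoeff₂ = D.chernCoeff₂ + 3 * D.chernCoeff₁ * t + 6 * t ^ 2 ∧
        (D.tw t).chernCoeff₃ = D.chernCoeff₃ + 2 * D.chernCoeff₂ * t + 3 * D.chernCoeff₁ * t ^ 2 + 4 * t ^ 3 := by
  simp only [Design.chernCoeff₁, Design.chernCoeff₂, Design.chernCoeff₃, D.coeff_one_tw hD h0 t, D.coeff_two_tw hD h0 t,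
    D.coeff_three_tw hD h0 t]
  push_cast
  refine ⟨by ring, by ring, by ring⟩

/-- **The E-form identity (L5⁺)(3) on the json side**: with `v_k(t) = Σ_{m ≤ k} γ_m t^{k−m}` (the coefficients of the Bloch pencil at twist
`t`), `Σ_{j ≥ i} γ_{3−j}(D(t))·C(j,i)·(−t)^{j−i} = v_{3−i}(t)` for `i = 0,1,2,3` — the Chern numbers of the twist recombine with the binomial
re-expansion of `σ̃_j^𝓕 = Σ_i C(j,i)(−t h)^{j−i} σ̃_i^𝓔` (`At(𝓔(tH)) = At(𝓔) − t·h`) into the pencil coefficients. Pure algebra given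
`Design.chernCoeff_tw`; the object-side half (the binomial re-expansion of `sigmaHigher` under a twist) is NOT in the tree. -/
theorem Design.pencilCoeff_tw (hD : D.Clean) (h0 : D.coeff 0 = 4) (t : ℤ) :
    (D.tw t).chernCoeff₁ + 3 * (-(t : ℚ)) = D.chernCoeff₁ + t ∧
      (D.tw t).chernCoeff₂ + (D.tw t).chernCoeff₁ * (2 * (-(t : ℚ))) + 3 * (-(t : ℚ)) ^ 2 =
          D.chernCoeff₂ + D.chernCoeff₁ * t + (t : ℚ) ^ 2 ∧
        (D.tw t).chernCoeff₃ + (D.tw t).chernCoeff₂ * (-(t : ℚ)) + (D.tw t).chernCoeff₁ * (-(t : ℚ)) ^ 2 + (-(t : ℚ)) ^ 3 =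
          D.chernCoeff₃ + D.chernCoeff₂ * t + D.chernCoeff₁ * (t : ℚ) ^ 2 + (t : ℚ) ^ 3 := by
  obtain ⟨e1, e2, e3⟩ := D.chernCoeff_tw hD h0 t
  rw [e1, e2, e3]
  refine ⟨by ring, by ring, by ring⟩

end JsonObject

end VTwentyOne

/-! ## Audit (v21): nothing is decided here

Defs: `BlochPencil.pencil`, `BlochPencil.pencilₗ` (pure algebra), `HodgeToBetti` (a structure = DATA, constructed by no one),
`cupSigma`, `sigmaThreeBetti`, `blochAdjugate`, `hCuppedSigma` (maps built from the REAL `sigmaHigher`, `cupProduct`, `chernOne∕Two∕Three`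
and the datum `ρ`), `dualTensorPow`, `KoszulWindowAcyclic` (a predicate on honest carriers) and `BlochAdjugateLaw` (a `Prop` — (L5⁺), the
one new piece of MATHEMATICS, consumed only as a hypothesis, never asserted). Every `theorem` is proved (linear algebra, bilinearity and
associativity of `∪`, repackaging through v4). `Design.seedCheck_of_zeroScheme_of_blochAdjugate`, `…_of_twistedKernelPresentation_…`,
`blochSeedDiscOne_of_zeroSchemes_of_blochAdjugate` carry BOTH laws, a realisation `ρ`, a rank-`4` bundle in the Koszul window with
injective adjugate trace, and a section with regular integral zero scheme among their hypotheses (data no one has constructed).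
No `sorry`, no new axiom, no `instance`, no `notation`. HC ∕ HC_CM ∕ HC_AV ∕ `BlochSeedDiscOne` are NOT proved here. -/

end Summit.HodgeConjecture.HodgeConjecture.Cruxes.BlochSeedDiscOne.SeedChecker

end
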